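import Mathlib.Analysis.Complex.Basic
import Mathlib.Analysis.SpecialFunctions.Pow.Real
import Mathlib.Algebra.BigOperators.Ring.Finset
import HarnessLib

/-!
# BLOCK REDUCTION (IMS localisation) for animal certificates: finitely many finite blocks certify the whole slab

`SemilocalDeletionAnimalFloor` (p389024) turns a LATTICE certificate — `0 ≤ μ Σ_F |G_k|² + Σ_n w_n Σ_F Re(G_{k+d_n} conj G_k + G_k conj G_{k+d_n})`
for EVERY finitely supported `G` on the slab — into the continuum floor `Re Q_{S'} ≥ Re Q_S − μ‖g‖₂²`.  For two or more small primes the slab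
graph is infinite, so the certificate quantifies over infinitely many configurations.  This file reduces it to configurations of BOUNDED
size, at an explicit price, by the IMS localisation formula (Ismagilov–Morgan–Simon–Sigal) written for lattice lag forms:

for a finite family of real windows `χ_j` with `Σ_j χ_j(k)² = 1` on the support `F` of `G` and
`Σ_j (χ_j(k + d_n) − χ_j(k))² ≤ ε_n` along every edge of `F`,

  `Σ_j LF(χ_j G) = LF(G) − Σ_n w_n Σ_k Re(…)·½Σ_j(χ_j(k+d_n) − χ_j(k))²`   (exact, `sum_latticeForm_localize`), hence

  **`latticeCert_of_blocks`**: if every localised vector `χ_j G` satisfies the certificate with constant `μ`, then `G` satisfies it with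
  constant `μ + Σ_n |w_n| ε_n`.

With windows of width `ℓ` sliced along one lattice coordinate (`ε_n = O(v(n)²/ℓ²)`) the blocks are slab pieces of bounded lattice diameter —
finitely many up to translation — so the animal supremum `μ*_T(c)` (cc-s2-1 gen17, ANIMAL-SUPREMUM.md) becomes CERTIFIABLE from finitely
many finite eigenvalue enclosures plus `O(ℓ⁻²)`.  Pure finite-dimensional algebra (Mathlib only); nothing here bears on RH.
-/

set_option linter.dupNamespace false

noncomputable section

open Complex Finset
open scoped ComplexConjugate

namespace Summit.RiemannHypothesis.RiemannHypothesis.Theorems.SemilocalDeletionAnimalBlocks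

variable {Λ : Type*} [AddCommGroup Λ] [DecidableEq Λ] {J : Type*}

/-! ## §1  Partition-of-unity algebra -/

/-- `Σ_j χ_j(x)χ_j(y) = 1 − ½ Σ_j (χ_j(x) − χ_j(y))²` when `Σ_j χ_j(x)² = Σ_j χ_j(y)² = 1`. -/
theorem sum_mul_eq_one_sub_half (s : Finset J) (a b : J → ℝ) (ha : ∑ j ∈ s, a j ^ 2 = 1) (hb : ∑ j ∈ s, b j ^ 2 = 1) :
    ∑ j ∈ s, a j * b j = 1 - (1 / 2) * ∑ j ∈ s, (a j - b j) ^ 2 := by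
  have e : ∑ j ∈ s, (a j - b j) ^ 2 = ∑ j ∈ s, a j ^ 2 + ∑ j ∈ s, b j ^ 2 - 2 * ∑ j ∈ s, a j * b j := by
    rw [Finset.mul_sum, ← Finset.sum_add_distrib, ← Finset.sum_sub_distrib]
    exact Finset.sum_congr rfl fun j _ ↦ by ring
  rw [e, ha, hb]
  ring

omit [AddCommGroup Λ] [DecidableEq Λ] in
/-- **The windows preserve the total norm**: `Σ_j Σ_F |χ_j(k) G_k|² = Σ_F |G_k|²` when `Σ_j χ_j(k)² = 1` on `F`. -/
theorem sum_norm_sq_localize (s : Finset J) (χ : J → Λ → ℝ) (F : Finset Λ) (G : Λ → ℂ)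
    (hχ1 : ∀ k ∈ F, ∑ j ∈ s, χ j k ^ 2 = 1) :
    ∑ j ∈ s, ∑ k ∈ F, ‖(χ j k : ℂ) * G k‖ ^ 2 = ∑ k ∈ F, ‖G k‖ ^ 2 := by
  have e : ∀ (r : ℝ) (z : ℂ), ‖(r : ℂ) * z‖ ^ 2 = r ^ 2 * ‖z‖ ^ 2 := fun r z ↦ by
    rw [norm_mul, mul_pow, Complex.norm_real, Real.norm_eq_abs, sq_abs]
  rw [Finset.sum_comm]
  refine Finset.sum_congr rfl fun k hk ↦ ?_
  simp_rw [e]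
  rw [← Finset.sum_mul, hχ1 k hk, one_mul]

/-- One edge, windowed: `Σ_j Re((χ_j(y)G_y) conj(χ_j(x)G_x) + (χ_j(x)G_x) conj(χ_j(y)G_y)) = (Σ_j χ_j(y)χ_j(x)) · Re(G_y conj G_x + G_x conj G_y)`. -/
theorem sum_re_pair_localize (s : Finset J) (cx cy : J → ℝ) (Gx Gy : ℂ) :
    ∑ j ∈ s, (((cy j : ℂ) * Gy) * conj ((cx j : ℂ) * Gx) + ((cx j : ℂ) * Gx) * conj ((cy j : ℂ) * Gy)).re =
      (∑ j ∈ s, cy j * cx j) * (Gy * conj Gx + Gx * conj Gy).re := by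
  rw [Finset.sum_mul]
  refine Finset.sum_congr rfl fun j _ ↦ ?_
  have e : ((cy j : ℂ) * Gy) * conj ((cx j : ℂ) * Gx) + ((cx j : ℂ) * Gx) * conj ((cy j : ℂ) * Gy) =
      ((cy j * cx j : ℝ) : ℂ) * (Gy * conj Gx + Gx * conj Gy) := by
    rw [map_mul, map_mul, Complex.conj_ofReal, Complex.conj_ofReal]
    push_cast
    ring
  rw [e, Complex.re_ofReal_mul]

/-! ## §2  The IMS identity for lattice lag forms -/

variable (s : Finset J) (χ : J → Λ → ℝ) (F : Finset Λ) (G : Λ → ℂ) (w : ℕ → ℝ) (d : ℕ → Λ) (N : ℕ)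

omit [DecidableEq Λ] in
/-- **IMS localisation identity.** For `G` vanishing off `F` and windows with `Σ_j χ_j² = 1` on `F`:
`Σ_j LF(χ_j G) = Σ_n w_n Σ_{k∈F} c_{n,k} · Re(G_{k+d_n} conj G_k + G_k conj G_{k+d_n})` with `c_{n,k} = Σ_j χ_j(k+d_n) χ_j(k)`. -/
theorem sum_latticeForm_localize :
    ∑ j ∈ s, ∑ n ∈ Finset.range (N + 1), w n * ∑ k ∈ F,
        (((χ j (k + d n) : ℂ) * G (k + d n)) * conj ((χ j k : ℂ) * G k) +
          ((χ j k : ℂ) * G k) * conj ((χ j (k + d n) : ℂ) * G (k + d n))).re =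
      ∑ n ∈ Finset.range (N + 1), w n * ∑ k ∈ F,
        (∑ j ∈ s, χ j (k + d n) * χ j k) * (G (k + d n) * conj (G k) + G k * conj (G (k + d n))).re := by
  rw [Finset.sum_comm]
  refine Finset.sum_congr rfl fun n _ ↦ ?_
  rw [← Finset.mul_sum, Finset.sum_comm]
  congr 1
  exact Finset.sum_congr rfl fun k _ ↦ sum_re_pair_localize s (fun j ↦ χ j k) (fun j ↦ χ j (k + d n)) (G k) (G (k + d n))

/-- Shifted norms are dominated by the total norm: `Σ_{k∈F} |G_{k+d}|² ≤ Σ_{k∈F} |G_k|²` for `G` vanishing off `F`. -/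
theorem sum_norm_sq_shift_le (hG : ∀ k, k ∉ F → G k = 0) (v : Λ) :
    ∑ k ∈ F, ‖G (k + v)‖ ^ 2 ≤ ∑ k ∈ F, ‖G k‖ ^ 2 := by
  have h1 : ∑ k ∈ F, ‖G (k + v)‖ ^ 2 = ∑ k ∈ F.filter (fun k ↦ k + v ∈ F), ‖G (k + v)‖ ^ 2 := by
    rw [Finset.sum_filter]
    refine Finset.sum_congr rfl fun k _ ↦ ?_
    split_ifs with h
    · rfl
    · rw [hG _ h, norm_zero, zero_pow two_ne_zero]
  have h2 : ∑ k ∈ F.filter (fun k ↦ k + v ∈ F), ‖G (k + v)‖ ^ 2 =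
      ∑ k' ∈ (F.filter (fun k ↦ k + v ∈ F)).image (fun k ↦ k + v), ‖G k'‖ ^ 2 := by
    rw [Finset.sum_image fun a _ b _ h ↦ add_right_cancel h]
  rw [h1, h2]
  refine Finset.sum_le_sum_of_subset_of_nonneg (fun k' hk' ↦ ?_) fun _ _ _ ↦ by positivity
  obtain ⟨k, hk, rfl⟩ := Finset.mem_image.1 hk'
  exact (Finset.mem_filter.1 hk).2

/-! ## §3  Block certificates imply the lattice certificate -/

/-- **BLOCK REDUCTION.**  Let `G` vanish off the finite set `F`, let the real windows `χ_j` (`j ∈ s`) satisfy `Σ_j χ_j(k)² = 1` on `F` and the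
gradient bound `Σ_j (χ_j(k + d_n) − χ_j(k))² ≤ ε_n` along every edge of `F` (`k, k + d_n ∈ F`, `ε_n ≥ 0`).  If every LOCALISED vector `χ_j G`
satisfies the lattice certificate with constant `μ`, then `G` satisfies it with constant `μ + Σ_n |w_n| ε_n`:
`0 ≤ (μ + Σ_n |w_n| ε_n) Σ_F |G_k|² + Σ_n w_n Σ_F Re(G_{k+d_n} conj G_k + G_k conj G_{k+d_n})`. -/
theorem latticeCert_of_blocks (hG : ∀ k, k ∉ F → G k = 0) (hχ1 : ∀ k ∈ F, ∑ j ∈ s, χ j k ^ 2 = 1) {ε : ℕ → ℝ}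
    (hε : ∀ n ∈ Finset.range (N + 1), 0 ≤ ε n)
    (hχ2 : ∀ n ∈ Finset.range (N + 1), ∀ k ∈ F, k + d n ∈ F → ∑ j ∈ s, (χ j (k + d n) - χ j k) ^ 2 ≤ ε n) {μ : ℝ}
    (hblock : ∀ j ∈ s, 0 ≤ μ * ∑ k ∈ F, ‖(χ j k : ℂ) * G k‖ ^ 2 + ∑ n ∈ Finset.range (N + 1), w n * ∑ k ∈ F,
        (((χ j (k + d n) : ℂ) * G (k + d n)) * conj ((χ j k : ℂ) * G k) +
          ((χ j k : ℂ) * G k) * conj ((χ j (k + d n) : ℂ) * G (k + d n))).re) :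
    0 ≤ (μ + ∑ n ∈ Finset.range (N + 1), |w n| * ε n) * ∑ k ∈ F, ‖G k‖ ^ 2 +
        ∑ n ∈ Finset.range (N + 1), w n * ∑ k ∈ F, (G (k + d n) * conj (G k) + G k * conj (G (k + d n))).re := by
  set NF := ∑ k ∈ F, ‖G k‖ ^ 2 with hNF
  set X : ℕ → Λ → ℝ := fun n k ↦ (G (k + d n) * conj (G k) + G k * conj (G (k + d n))).re with hX
  set c : ℕ → Λ → ℝ := fun n k ↦ ∑ j ∈ s, χ j (k + d n) * χ j k with hc
  -- sum the block certificates over j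
  have hsum := Finset.sum_nonneg hblock
  rw [Finset.sum_add_distrib, ← Finset.mul_sum, sum_norm_sq_localize s χ F G hχ1, sum_latticeForm_localize s χ F G w d N] at hsum
  -- compare each windowed edge coefficient with 1
  have hbound : ∀ n ∈ Finset.range (N + 1), |∑ k ∈ F, (c n k - 1) * X n k| ≤ ε n * NF := by
    intro n hn
    have hXk : ∀ k ∈ F, |(c n k - 1) * X n k| ≤ ε n / 2 * (‖G (k + d n)‖ ^ 2 + ‖G k‖ ^ 2) := by
      intro k hk
      by_cases hkd : k + d n ∈ F
      · have hcn : c n k = 1 - (1 / 2) * ∑ j ∈ s, (χ j (k + d n) - χ j k) ^ 2 :=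
          sum_mul_eq_one_sub_half s _ _ (hχ1 _ hkd) (hχ1 k hk)
        have h1 : |c n k - 1| ≤ ε n / 2 := by
          rw [hcn, show (1 : ℝ) - 1 / 2 * ∑ j ∈ s, (χ j (k + d n) - χ j k) ^ 2 - 1 =
            -(1 / 2 * ∑ j ∈ s, (χ j (k + d n) - χ j k) ^ 2) by ring, abs_neg,
            abs_of_nonneg (mul_nonneg (by norm_num) (Finset.sum_nonneg fun _ _ ↦ sq_nonneg _))]
          linarith [hχ2 n hn k hk hkd]
        have h2 : |X n k| ≤ ‖G (k + d n)‖ ^ 2 + ‖G k‖ ^ 2 := by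
          have hr := abs_re_le_norm (G (k + d n) * conj (G k) + G k * conj (G (k + d n)))
          have htri := norm_add_le (G (k + d n) * conj (G k)) (G k * conj (G (k + d n)))
          rw [norm_mul, norm_mul, Complex.norm_conj, Complex.norm_conj] at htri
          have := two_mul_le_add_sq ‖G (k + d n)‖ ‖G k‖
          simp only [hX]
          nlinarith [norm_nonneg (G (k + d n)), norm_nonneg (G k)]
        rw [abs_mul]
        have := mul_le_mul h1 h2 (abs_nonneg _) (by linarith [hε n hn])
        linarith
      · have h0 : X n k = 0 := by simp only [hX, hG _ hkd, zero_mul, map_zero, mul_zero, add_zero, Complex.zero_re]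
        rw [h0, mul_zero, abs_zero]
        exact mul_nonneg (div_nonneg (hε n hn) (by norm_num)) (by positivity)
    calc |∑ k ∈ F, (c n k - 1) * X n k| ≤ ∑ k ∈ F, |(c n k - 1) * X n k| := Finset.abs_sum_le_sum_abs _ _
      _ ≤ ∑ k ∈ F, ε n / 2 * (‖G (k + d n)‖ ^ 2 + ‖G k‖ ^ 2) := Finset.sum_le_sum hXk
      _ = ε n / 2 * (∑ k ∈ F, ‖G (k + d n)‖ ^ 2 + NF) := by
          rw [← Finset.mul_sum, Finset.sum_add_distrib]
      _ ≤ ε n / 2 * (NF + NF) := by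
          have := sum_norm_sq_shift_le F G hG (d n)
          have := hε n hn
          nlinarith
      _ = ε n * NF := by ring
  -- Σ_n w_n Σ_k c X = Σ_n w_n Σ_k X + Σ_n w_n Σ_k (c - 1) X, and the second sum is ≥ -Σ |w_n| ε_n NF
  have hsplit : ∑ n ∈ Finset.range (N + 1), w n * ∑ k ∈ F, c n k * X n k =
      ∑ n ∈ Finset.range (N + 1), w n * ∑ k ∈ F, X n k +
        ∑ n ∈ Finset.range (N + 1), w n * ∑ k ∈ F, (c n k - 1) * X n k := by
    rw [← Finset.sum_add_distrib]
    refine Finset.sum_congr rfl fun n _ ↦ ?_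
    rw [← mul_add, ← Finset.sum_add_distrib]
    congr 1
    exact Finset.sum_congr rfl fun k _ ↦ by ring
  have herr : ∑ n ∈ Finset.range (N + 1), w n * ∑ k ∈ F, (c n k - 1) * X n k ≤
      (∑ n ∈ Finset.range (N + 1), |w n| * ε n) * NF := by
    rw [Finset.sum_mul]
    refine Finset.sum_le_sum fun n hn ↦ ?_
    have h1 := hbound n hn
    have h2 : |w n * ∑ k ∈ F, (c n k - 1) * X n k| ≤ |w n| * (ε n * NF) := by
      rw [abs_mul]; exact mul_le_mul_of_nonneg_left h1 (abs_nonneg _)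
    have := le_abs_self (w n * ∑ k ∈ F, (c n k - 1) * X n k)
    linarith
  have hmain : 0 ≤ μ * NF + (∑ n ∈ Finset.range (N + 1), w n * ∑ k ∈ F, X n k +
      ∑ n ∈ Finset.range (N + 1), w n * ∑ k ∈ F, (c n k - 1) * X n k) := by
    rw [← hsplit]
    simpa only [hc, hX] using hsum
  rw [add_mul]
  simp only [hX] at hmain herr ⊢
  linarith

end Summit.RiemannHypothesis.RiemannHypothesis.Theorems.SemilocalDeletionAnimalBlocks

end
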